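import Summits.Ventures.QEC.CircuitDistance.ETowerNodes345X
import Summits.Ventures.QEC.CircuitDistance.ETowerTops345X
import Summits.Ventures.QEC.CircuitDistance.ETowerCount345X
import Summits.Ventures.QEC.CircuitDistance.ETowerBase
import Summits.Ventures.QEC.CircuitDistance.ETowerZeroZ
import Summits.Ventures.QEC.CircuitDistance.ETowerZeroMini345X
import Summits.Ventures.QEC.CircuitDistance.ETowerZeros345DX
import Summits.Ventures.QEC.CircuitDistance.SchedK2InstBB144o345CheckX
import Summits.Ventures.QEC.CircuitDistance.SchedK2LogicalsBB144o345X
import Summits.Ventures.QEC.CircuitDistance.Transport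
import HarnessLib

/-!
# #345 E-fold tower (`[[144,12,12]]` under CNOT order #345, W = 10, node J), sector X: THE ASSEMBLY — from the unit / window /
# base-slice / zero-fibre facts to the K2 completeness binder `Transport.K2X bb144SM o345XTable 10 LX` by plain `decide`
# (cell `qec`, experiment CDX; seat qec-cdx-type-2 g1; the #345 twin of type-1's `ETowerSoundX`, STEP2-ASSEMBLY-SPEC §C)

`kc345X_of_data`: the KERNEL-COMPLETENESS statement `KC345X` of the #345 extended code (every kernel word of `d345X.synOf` of weight
`≤ 10` has all logical parities zero or is a translate of one of the 246 anchored `TOPS`) from FOUR data inputs, each a conjunction of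
`decide +kernel` facts emitted by eng-1 / idea-1:  (U) units — `nodeA (bitsOf 45 0 t) = true` for every base numeral `t ∈ T3`;
(W) windows — `nodeCW L w = true` for the 13 × 8 words/windows;  (B) base slices — `sliceCheck col3 3 3 5 10 T3 = true`,
`Fibre.incr T3 = true`, orbit-size sums `osum 3 3 5 w T3 = NW[w]` (w = 1..10);  (Z) the step-A zero fibre `GoodFibK GA 5 col2 10 NB 0`
— here DISCHARGED (`zeroA345X`, given the window-certified classes `hW3`) from idea-1 g5's LANDED zero-fibre modules in `hD` form:
level C from the (α) mini-tower `ETowerZeroMini345X` (`Zeros.hDC hMC`, node fact `Zeros.hdC`), levels B / A from the banded brute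
certificates `ETowerZero345SoundX` (`Zeros.hDB hMB hK1`, `Zeros.hDA hMA hK2`) and `ETowerZeros345DX` (`Zeros.hdB`, `Zeros.hdA`),
through `ETowerZero.goodFibK_zero` and `goodQ_of_bits_doubleK`.  `k2X345_of_kc`: with the #345 K2 instance (`good345X`, `hlog345X`,
`hidx345`) and the `TOPS`-versus-leaves certificate (`hTOPS`, `ETowerTops345X.topsCheck345`), `ETowerBinder.binder_of_kc` turns `KC345X`
into `Transport.K2X bb144SM o345XTable 10 LX` — the `hK` of type-2's `sched345_circuitDistance_eq_eleven_of_xLeaves` (SchedLeafTransport345);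
★ `k2X345_of_towerData`: that binder from the `TOPS` certificate + units + windows + base slices ONLY (zeros already in the tree).
Nothing here asserts a value of `d_circ`.
-/

set_option maxRecDepth 100000
set_option exponentiation.threshold 1024

namespace Summit.Ventures.QEC.CircuitDistance.ETower.Sec345X

open Literature.InformationTheory.QuantumCodes Summit.Ventures.QEC.Census Summit.Ventures.QEC.Census.Fold
  Summit.Ventures.QEC.CircuitDistance.ETower Finset K2

/-- The KERNEL-COMPLETENESS statement of the #345 X tower: every kernel word of the #345 syndrome table of weight `≤ 10` has all
logical parities zero or is a translate of a listed anchored class. -/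
def KC345X : Prop := ∀ u, u < 2 ^ nK GC 5 → kerK col0 (nK GC 5) u → popc (nK GC 5) u ≤ 10 → QT u

/-- ★ **THE #345 TOWER GIVES `KC345X`** from the four data inputs. -/
theorem kc345X_of_data {T3 : List ℕ}
    (hU : ∀ t ∈ T3, nodeA (bitsOf 45 0 t) = true)
    (hW : ∀ L ∈ W3L, ∀ w ∈ W3WIN3, nodeCW L w = true)
    (hBcheck : sliceCheck col3 3 3 5 10 T3 = true) (hBincr : Fibre.incr T3 = true)
    (hBsum : ∀ w, 1 ≤ w → w ≤ 10 → osum 3 3 5 w T3 = NW.getD w 0)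
    (hZ : GoodFibK GA 5 col2 10 NB 0) : KC345X := by
  have hW3 : ∀ r ∈ W3C, NC r := hW3_of_wins345 hW
  -- units as fibre properties at the base numerals
  have hunits : ∀ t ∈ T3, GoodFibK GA 5 col2 10 NB t := by
    intro t ht
    have hlt : t < 2 ^ (5 * (3 * 3)) := (of_sliceCheck hBcheck t ht).1
    have h := hkA345 hW3 (bitsOf 45 0 t) (fun j hj => lt_of_lt_of_eq (lt_of_mem_bitsOf hj) (by decide)) (hU t ht)
    rwa [maskOf_bitsOf_zero _ _ hlt] at h
  -- base certificate
  have hbase : ∀ s, s < 2 ^ nsK GA 5 → kerK col3 (nsK GA 5) s → popc (nsK GA 5) s ≤ 10 → s = 0 ∨ MatchedK GA.ls GA.ms 5 T3 s := by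
    have e : nsK GA 5 = 5 * (3 * 3) := by decide
    rw [e]
    exact base_of_slices (ls := 3) (ms := 3) (by decide) (by decide) hK3 T3 hBcheck hBincr
      (fun w h1 hw => by rw [hBsum w h1 hw]; exact (card_Xw_345X hw).symm)
  -- the composed tower
  exact kc_of_tower SecZ.shapeA SecZ.shapeB SecZ.shapeC SecZ.okA SecZ.okB SecZ.okC ⟨by decide, by decide⟩ ⟨by decide, by decide⟩
    hRA hRB hRC hK2 hK1 hK0 hQT345 hbase hunits hZ

/-- ★ **`Transport.K2X bb144SM o345XTable 10 LX` FROM THE TOWER**: given `KC345X` and the certificate that the 246 anchored top classes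
are translates of words of `LX` (`hTOPS`, from `topsCheck345 LX wit = true`), every `X`-nontrivial class-word of weight `≤ 10` over
`o345XTable` is a translate of a word of `LX`. -/
theorem k2X345_of_kc (LX : List (LeafEntry 12 6))
    (hTOPS : ∀ r ∈ TOPS, ∃ wd ∈ LX.map (·.word), ∃ t : BB.Mono 12 6,
      ((bitsOf (5 * (12 * 6)) 0 r).map inst345X.G).toFinset = (wd.map (trQ t)).toFinset)
    (hKC : KC345X) : Transport.K2X bb144SM o345XTable 10 LX := by
  intro x hcls hnt hcard
  have hx : ∀ g ∈ x, g ∈ inst345X.gsupp := fun g hg => mem_gsupp345X_of_isXClass (hcls g hg)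
  obtain ⟨wd, hwd, t, hxt⟩ := binder_of_kc (I := inst345X) (good345X _) BB144Log345.hlog345X (by decide) (by decide) (nb := 5)
    (W := 10) (TOPS := TOPS) rfl (fun u hu hk hw => hKC u hu hk hw) hTOPS hidx345 x hx hnt.1 hnt.2 hcard
  obtain ⟨e, he, rfl⟩ := List.mem_map.1 hwd
  exact ⟨e, he, t, hxt⟩

/-- ★★ **`Transport.K2X bb144SM o345XTable 10 LX` from the four data inputs and the `TOPS` certificate.** -/
theorem k2X345_of_data (LX : List (LeafEntry 12 6)) {wit : List (ℕ × ℕ × ℕ)} (htops : topsCheck345 LX wit = true) {T3 : List ℕ}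
    (hU : ∀ t ∈ T3, nodeA (bitsOf 45 0 t) = true)
    (hW : ∀ L ∈ W3L, ∀ w ∈ W3WIN3, nodeCW L w = true)
    (hBcheck : sliceCheck col3 3 3 5 10 T3 = true) (hBincr : Fibre.incr T3 = true)
    (hBsum : ∀ w, 1 ≤ w → w ≤ 10 → osum 3 3 5 w T3 = NW.getD w 0)
    (hZ : GoodFibK GA 5 col2 10 NB 0) : Transport.K2X bb144SM o345XTable 10 LX :=
  k2X345_of_kc LX (hTOPS_of_topsCheck345 htops) (kc345X_of_data hU hW hBcheck hBincr hBsum hZ)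

/-! ## The step-A zero fibre (§B10) in the `hD` form the zero lanes deliver (crit-1 g3 R1, appendix_t2 §E2 verbatim) -/

/-- level C from a ZeroD-form fact (`Zeros.hDC hMC`) and the D-list node fact (`Zeros.hdC`). -/
theorem levelC_zero_of_hDC345X {DC : List ℕ}
    (hDC : ∀ c, c < 2 ^ nsK GC 5 → 2 * popc (nsK GC 5) c ≤ 10 → kerK col0 (nK GC 5) (doubleK GC 5 c) →
      c = 0 ∨ MatchedK GC.ls GC.ms 5 DC c)
    (hdC : ∀ c ∈ DC, ktop (bitsOf 360 0 (doubleK GC 5 c)) = true) : NC 0 :=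
  goodFibK_zero (G := GC) SecZ.shapeC SecZ.okC hK0 (Q := QT) hQT345 qTop_zero DC hDC
    (fun c hc _ => goodQ_of_bits_doubleK (G := GC) SecZ.okC (by decide) (node := ktop) (fun S hS hl h => hktop345 S hS hl h) (hdC c hc))

/-- levels B and A from ZeroD-form facts (`Zeros.hDB hMB hK1`, `Zeros.hDA hMA hK2`) and the D-list node facts, given `NC 0`. -/
theorem zeroA_of_hD345X (hW3 : ∀ r ∈ W3C, NC r) (hC0 : NC 0) {DA DB : List ℕ}
    (hDB : ∀ c, c < 2 ^ nsK GB 5 → 2 * popc (nsK GB 5) c ≤ 10 → kerK col1 (nK GB 5) (doubleK GB 5 c) →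
      c = 0 ∨ MatchedK GB.ls GB.ms 5 DB c)
    (hdB : ∀ c ∈ DB, nodeC (bitsOf 180 0 (doubleK GB 5 c)) = true)
    (hDA : ∀ c, c < 2 ^ nsK GA 5 → 2 * popc (nsK GA 5) c ≤ 10 → kerK col2 (nK GA 5) (doubleK GA 5 c) →
      c = 0 ∨ MatchedK GA.ls GA.ms 5 DA c)
    (hdA : ∀ c ∈ DA, nodeB (bitsOf 90 0 (doubleK GA 5 c)) = true) :
    GoodFibK GA 5 col2 10 NB 0 := by
  have hB0 : NB 0 := goodFibK_zero (G := GB) SecZ.shapeB SecZ.okB hK1 (Q := NC) hNC345 hC0 DB hDB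
    (fun c hc _ => goodQ_of_bits_doubleK (G := GB) SecZ.okB (by decide) (node := nodeC) (fun S hS _ h => hkC345 hW3 S hS h) (hdB c hc))
  exact goodFibK_zero (G := GA) SecZ.shapeA SecZ.okA hK2 (Q := NB) hNB345 hB0 DA hDA
    (fun c hc _ => goodQ_of_bits_doubleK (G := GA) SecZ.okA (by decide) (node := nodeB) (fun S hS _ h => hkB345 hW3 S hS h) (hdA c hc))

/-- ★ eleven-binder value interface in the hD form: what the value file can discharge from the tree as the zero lanes stand. -/
theorem k2X345_of_hD (LX : List (LeafEntry 12 6)) {wit : List (ℕ × ℕ × ℕ)} (htops : topsCheck345 LX wit = true)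
    {T3 DA DB DC : List ℕ}
    (hU : ∀ t ∈ T3, nodeA (bitsOf 45 0 t) = true)
    (hW : ∀ L ∈ W3L, ∀ w ∈ W3WIN3, nodeCW L w = true)
    (hBcheck : sliceCheck col3 3 3 5 10 T3 = true) (hBincr : Fibre.incr T3 = true)
    (hBsum : ∀ w, 1 ≤ w → w ≤ 10 → osum 3 3 5 w T3 = NW.getD w 0)
    (hDC : ∀ c, c < 2 ^ nsK GC 5 → 2 * popc (nsK GC 5) c ≤ 10 → kerK col0 (nK GC 5) (doubleK GC 5 c) →
      c = 0 ∨ MatchedK GC.ls GC.ms 5 DC c)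
    (hdC : ∀ c ∈ DC, ktop (bitsOf 360 0 (doubleK GC 5 c)) = true)
    (hDB : ∀ c, c < 2 ^ nsK GB 5 → 2 * popc (nsK GB 5) c ≤ 10 → kerK col1 (nK GB 5) (doubleK GB 5 c) →
      c = 0 ∨ MatchedK GB.ls GB.ms 5 DB c)
    (hdB : ∀ c ∈ DB, nodeC (bitsOf 180 0 (doubleK GB 5 c)) = true)
    (hDA : ∀ c, c < 2 ^ nsK GA 5 → 2 * popc (nsK GA 5) c ≤ 10 → kerK col2 (nK GA 5) (doubleK GA 5 c) →
      c = 0 ∨ MatchedK GA.ls GA.ms 5 DA c)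
    (hdA : ∀ c ∈ DA, nodeB (bitsOf 90 0 (doubleK GA 5 c)) = true) : Transport.K2X bb144SM o345XTable 10 LX :=
  k2X345_of_data LX htops hU hW hBcheck hBincr hBsum
    (zeroA_of_hD345X (hW3_of_wins345 hW) (levelC_zero_of_hDC345X hDC hdC) hDB hdB hDA hdA)

/-! ## … and DISCHARGED from the landed zero modules of idea-1 g5 ((α) mini-tower, AB lane) -/

/-- **The level-C zero fact `NC 0` of the #345 X tower** from the landed (α) mini-tower `ETowerZeroMini345X` (`Zeros.hDC`) and
`ETowerZeroMini345XD` (`Zeros.hdC`). -/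
theorem levelC_zero345X : NC 0 := levelC_zero_of_hDC345X (Zeros.hDC hMC) Zeros.hdC

/-- ★ **THE STEP-A ZERO FIBRE of the #345 X tower**, given the window-certified low-weight classes, from the landed zero modules
(`ETowerZero345SoundX`: `Zeros.hDB/hDA`; `ETowerZeros345DX`: `Zeros.hdB/hdA`; level C above). -/
theorem zeroA345X (hW3 : ∀ r ∈ W3C, NC r) : GoodFibK GA 5 col2 10 NB 0 :=
  zeroA_of_hD345X hW3 levelC_zero345X (Zeros.hDB hMB hK1) Zeros.hdB (Zeros.hDA hMA hK2) Zeros.hdA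

/-- ★★ **`Transport.K2X bb144SM o345XTable 10 LX` from the TOWER DATA only**: the `TOPS` certificate, eng-1's units, windows and base slices
(the zero fibres are in the tree). -/
theorem k2X345_of_towerData (LX : List (LeafEntry 12 6)) {wit : List (ℕ × ℕ × ℕ)} (htops : topsCheck345 LX wit = true) {T3 : List ℕ}
    (hU : ∀ t ∈ T3, nodeA (bitsOf 45 0 t) = true)
    (hW : ∀ L ∈ W3L, ∀ w ∈ W3WIN3, nodeCW L w = true)
    (hBcheck : sliceCheck col3 3 3 5 10 T3 = true) (hBincr : Fibre.incr T3 = true)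
    (hBsum : ∀ w, 1 ≤ w → w ≤ 10 → osum 3 3 5 w T3 = NW.getD w 0) : Transport.K2X bb144SM o345XTable 10 LX :=
  k2X345_of_data LX htops hU hW hBcheck hBincr hBsum (zeroA345X (hW3_of_wins345 hW))

end Summit.Ventures.QEC.CircuitDistance.ETower.Sec345X
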